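import Summits.ResolutionOfSingularities.ResolutionOfSingularities.Theorems.FrobeniusLadderFInjectiveMacaulayficationTrFullStepDoor
import Summits.ResolutionOfSingularities.ResolutionOfSingularities.Theorems.FrobeniusLadderFInjectiveMacaulayficationDimSliceOfCesnavicius
import Summits.ResolutionOfSingularities.ResolutionOfSingularities.Theorems.FrobeniusLadderFInjectiveMacaulayficationSingFullTower
import Summits.ResolutionOfSingularities.ResolutionOfSingularities.Theorems.CossartPiltant2019PrincipalizationHolds
import HarnessLib

/-!
# Door v41 and its slices with THREE printed hypotheses: conjunct F-77 (Cossart–Piltant 2019 Prop. 4.4) CONSUMED BY NAME from the tree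
# (crux `FInjectiveMacaulayfication` stmt-ResolutionOfSingularities-15315, chain w45a; res-L1-w45a-plan-1 R20.1/R21.3 (F-77 closed by name — cite, do not re-register, R18.16); seat res-L1-w45a-lead-1 g10, registrar)

[OURS · L1 W4.5a] Support file (`--supports stmt-ResolutionOfSingularities-15315 --as helper`); def-free; CONDITIONAL results (named-fact hypotheses = the three remaining prints; research
hypotheses = the registered stubs of v41 / the held stubs of v44). Nothing of the crux is proved. AI-written (AI review is weaker than expert review).

The registered door v41 `Lines/step_door.lean` 554affabf0e9e2f3 carries `stub_namedFacts` = FOUR prints. The INPUTS desk has since CLOSED the third one in the tree: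
`CP2008Prop44.CossartPiltant2019Principalization_holds : CossartPiltant2019Principalization` (module `…Theorems.CossartPiltant2019PrincipalizationHolds`, from F-71; axioms standard). The door is
NOT re-lettered for this (pace rule R18.16); instead this file records the door terms and the per-dimension slices with the conjunct consumed, so that the hole map's «H_prints = three
hypotheses» is a kernel statement:
* ★ `fInjectiveMacaulayfication_of_threePrints_of_LFadmF_of_tStepOne` — crux ⟸ CP 2019 Thm 1.1 ∧ Stacks 081R ∧ Česnavičius 5.3-(B) ∧ F-half ∧ T″(·,·,1) (v41's deciding term minus F-77);
* ★ `fInjectiveMacaulayfication_dimLe4_of_threePrints_of_F4` — dim ≤ 4 ⟸ the three prints ∧ F(4) (no resolution residue);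
* `fInjectiveMacaulayfication_dimLe5_of_threePrints_of_tStep41_of_F45` — dim ≤ 5 ⟸ the three prints ∧ F(4) ∧ F(5) ∧ T″(p,4,1);
* `fInjectiveMacaulayfication_of_threePrints_of_singTowers` — the held line v44's door term minus F-77 (Sing_red tower conjectures, OUR candidates, HELD).
[cite: CossartPiltant2019, Thm. 1.1; Prop. 4.4] [cite: StacksProject, Tag 081R] [cite: Cesnavicius2021, Thm. 5.3] [cite: CossartPiltant2008, Prop. 4.4]
-/

-- single-problem summit: the doubled namespace component is forced
set_option linter.dupNamespace false

noncomputable section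

open AlgebraicGeometry CategoryTheory Literature.AlgebraicGeometry.Resolution TopologicalSpace IsLocalRing

namespace Summit.ResolutionOfSingularities.ResolutionOfSingularities.Theorems.FInjectiveMacaulayfication.StepDoorThreePrints

open Summit.ResolutionOfSingularities.ResolutionOfSingularities.Theorems.FInjectiveMacaulayfication
open SliceableCentre TrFullStep

/-- ★ **THE v41 DOOR WITH THREE PRINTS**: crux ⟸ CP 2019 Thm 1.1 ∧ Stacks 081R ∧ Česnavičius 2021 Thm 5.3-(B) ∧ the F-half ∧ T″(p,e,1) (e ≥ 4) — Cossart–Piltant 2019 Prop. 4.4 supplied by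
the tree theorem `CP2008Prop44.CossartPiltant2019Principalization_holds`. [OURS · conditional-result] -/
theorem fInjectiveMacaulayfication_of_threePrints_of_LFadmF_of_tStepOne
    (hG : CossartPiltant2019General.{0}) (h081R : Stacks081R.{0}) (hM : CesnaviciusBlowupMacaulayficationOffClosed.{0})
    (hLF : LocalFullificationFibreAdmGe4Split.LocalFInjectivizationFibreAdmGe4)
    (hT1 : ∀ p e : ℕ, p.Prime → 4 ≤ e → LocalRegularizationFibreFullTr p e 1) :
    Summit.ResolutionOfSingularities.ResolutionOfSingularities.Theses.FrobeniusLadder.FInjectiveMacaulayfication :=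
  TrFullStepDoor.fInjectiveMacaulayfication_of_prints_of_LFadmF_of_tStepOne hG h081R
    Summit.ResolutionOfSingularities.ResolutionOfSingularities.Theorems.CP2008Prop44.CossartPiltant2019Principalization_holds.{0} hM hLF hT1

/-- ★ **dim ≤ 4 ⟸ THREE PRINTS ∧ F(4)** — on schemes of dimension ≤ 4 the crux needs only CP 2019 Thm 1.1, Stacks 081R, Česnavičius 5.3-(B) and the F-half AT LEVEL 4; no resolution
residue, and Cossart–Piltant 2019 Prop. 4.4 is the tree's theorem. [OURS · conditional-result] -/
theorem fInjectiveMacaulayfication_dimLe4_of_threePrints_of_F4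
    (hG : CossartPiltant2019General.{0}) (h081R : Stacks081R.{0}) (hM : CesnaviciusBlowupMacaulayficationOffClosed.{0})
    (hF4 : ∀ (p : ℕ), p.Prime → ∀ (k : Type) [Field k] [CharP k p]
    (X : Scheme.{0}) (f : X ⟶ Spec (.of k)),
      IsSeparated f → LocallyOfFiniteType f → QuasiCompact f → IsIntegral X →
      ∀ x : X, IsClosed ({x} : Set X) → x ∉ Scheme.regularLocus X → ringKrullDim (X.presheaf.stalk x) = 4 →
      ∀ (S' : Scheme.{0}) (g : S' ⟶ Spec (X.presheaf.stalk x)) (I : (Spec (X.presheaf.stalk x)).IdealSheafData),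
        I ≠ ⊥ → (I.support : Set (Spec (X.presheaf.stalk x))) ⊆ (Scheme.regularLocus (Spec (X.presheaf.stalk x)))ᶜ → IsBlowup g I →
        (∀ s : S', g.base s ≠ closedPoint (X.presheaf.stalk x) → s ∈ Scheme.regularLocus S') →
        (∀ s : S', CMCl (S'.presheaf.stalk s)) →
        ∃ 𝓚 : S'.IdealSheafData, 𝓚 ≠ ⊥ ∧ (∀ s ∈ (𝓚.support : Set S'), g.base s = closedPoint (X.presheaf.stalk x)) ∧
          ∀ (S'' : Scheme.{0}) (π : S'' ⟶ S'), IsBlowup π 𝓚 →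
            ∀ s : S'', FullCl p (S''.presheaf.stalk s)) :
    ∀ p : ℕ, p.Prime → ∀ (k : Type) [Field k] [CharP k p] (X : Scheme.{0}) (f : X ⟶ Spec (.of k)),
      IsSeparated f → LocallyOfFiniteType f → QuasiCompact f → IsReduced X → topologicalKrullDim X ≤ 4 →
      ∃ (X' : Scheme.{0}) (π : X' ⟶ X), IsProper π ∧ IsBirational π ∧ ∀ x : X',
        IsDomain (X'.presheaf.stalk x) ∧ ∀ d : ℕ, ringKrullDim (X'.presheaf.stalk x) = d →
          ∀ s : Fin d → X'.presheaf.stalk x, (Ideal.span (Set.range s)).radical.IsMaximal →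
            RingTheory.Sequence.IsWeaklyRegular (X'.presheaf.stalk x) (List.ofFn s) ∧
            ∀ y : X'.presheaf.stalk x, (∃ e : ℕ, y ^ p ^ e ∈ Ideal.span
              ((fun z : X'.presheaf.stalk x => z ^ p ^ e) ''
                (Ideal.span (Set.range s) : Set (X'.presheaf.stalk x)))) →
              y ∈ Ideal.span (Set.range s) :=
  DimSliceOfCesnavicius.fInjectiveMacaulayfication_dimLe4_of_cesnaviciusOffClosed_of_F4 hG h081R
    Summit.ResolutionOfSingularities.ResolutionOfSingularities.Theorems.CP2008Prop44.CossartPiltant2019Principalization_holds.{0} hM hF4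

/-- **dim ≤ 5 ⟸ THREE PRINTS ∧ F(4) ∧ F(5) ∧ T″(p,4,1).** [OURS · conditional-result] -/
theorem fInjectiveMacaulayfication_dimLe5_of_threePrints_of_tStep41_of_F45
    (hG : CossartPiltant2019General.{0}) (h081R : Stacks081R.{0}) (hM : CesnaviciusBlowupMacaulayficationOffClosed.{0})
    (hT41 : ∀ p : ℕ, p.Prime → LocalRegularizationFibreFullTr p 4 1)
    (hF4 : ∀ (p : ℕ), p.Prime → ∀ (k : Type) [Field k] [CharP k p]
    (X : Scheme.{0}) (f : X ⟶ Spec (.of k)),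
      IsSeparated f → LocallyOfFiniteType f → QuasiCompact f → IsIntegral X →
      ∀ x : X, IsClosed ({x} : Set X) → x ∉ Scheme.regularLocus X → ringKrullDim (X.presheaf.stalk x) = 4 →
      ∀ (S' : Scheme.{0}) (g : S' ⟶ Spec (X.presheaf.stalk x)) (I : (Spec (X.presheaf.stalk x)).IdealSheafData),
        I ≠ ⊥ → (I.support : Set (Spec (X.presheaf.stalk x))) ⊆ (Scheme.regularLocus (Spec (X.presheaf.stalk x)))ᶜ → IsBlowup g I →
        (∀ s : S', g.base s ≠ closedPoint (X.presheaf.stalk x) → s ∈ Scheme.regularLocus S') →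
        (∀ s : S', CMCl (S'.presheaf.stalk s)) →
        ∃ 𝓚 : S'.IdealSheafData, 𝓚 ≠ ⊥ ∧ (∀ s ∈ (𝓚.support : Set S'), g.base s = closedPoint (X.presheaf.stalk x)) ∧
          ∀ (S'' : Scheme.{0}) (π : S'' ⟶ S'), IsBlowup π 𝓚 → ∀ s : S'', FullCl p (S''.presheaf.stalk s))
    (hF5 : ∀ (p : ℕ), p.Prime → ∀ (k : Type) [Field k] [CharP k p]
    (X : Scheme.{0}) (f : X ⟶ Spec (.of k)),
      IsSeparated f → LocallyOfFiniteType f → QuasiCompact f → IsIntegral X →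
      ∀ x : X, IsClosed ({x} : Set X) → x ∉ Scheme.regularLocus X → ringKrullDim (X.presheaf.stalk x) = 5 →
      ∀ (S' : Scheme.{0}) (g : S' ⟶ Spec (X.presheaf.stalk x)) (I : (Spec (X.presheaf.stalk x)).IdealSheafData),
        I ≠ ⊥ → (I.support : Set (Spec (X.presheaf.stalk x))) ⊆ (Scheme.regularLocus (Spec (X.presheaf.stalk x)))ᶜ → IsBlowup g I →
        (∀ s : S', g.base s ≠ closedPoint (X.presheaf.stalk x) → s ∈ Scheme.regularLocus S') →
        (∀ s : S', CMCl (S'.presheaf.stalk s)) →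
        ∃ 𝓚 : S'.IdealSheafData, 𝓚 ≠ ⊥ ∧ (∀ s ∈ (𝓚.support : Set S'), g.base s = closedPoint (X.presheaf.stalk x)) ∧
          ∀ (S'' : Scheme.{0}) (π : S'' ⟶ S'), IsBlowup π 𝓚 → ∀ s : S'', FullCl p (S''.presheaf.stalk s)) :
    ∀ p : ℕ, p.Prime → ∀ (k : Type) [Field k] [CharP k p] (X : Scheme.{0}) (f : X ⟶ Spec (.of k)),
      IsSeparated f → LocallyOfFiniteType f → QuasiCompact f → IsReduced X → topologicalKrullDim X ≤ 5 →
      ∃ (X' : Scheme.{0}) (π : X' ⟶ X), IsProper π ∧ IsBirational π ∧ ∀ x : X',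
        IsDomain (X'.presheaf.stalk x) ∧ ∀ d : ℕ, ringKrullDim (X'.presheaf.stalk x) = d →
          ∀ s : Fin d → X'.presheaf.stalk x, (Ideal.span (Set.range s)).radical.IsMaximal →
            RingTheory.Sequence.IsWeaklyRegular (X'.presheaf.stalk x) (List.ofFn s) ∧
            ∀ y : X'.presheaf.stalk x, (∃ e : ℕ, y ^ p ^ e ∈ Ideal.span
              ((fun z : X'.presheaf.stalk x => z ^ p ^ e) ''
                (Ideal.span (Set.range s) : Set (X'.presheaf.stalk x)))) →
              y ∈ Ideal.span (Set.range s) :=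
  TrFullStepDoor.fInjectiveMacaulayfication_dimLe5_of_cesnaviciusOffClosed_of_tStep41_of_F45 hG h081R
    Summit.ResolutionOfSingularities.ResolutionOfSingularities.Theorems.CP2008Prop44.CossartPiltant2019Principalization_holds.{0} hM hT41 hF4 hF5

/-- **THE HELD LINE v44's DOOR TERM WITH THREE PRINTS**: crux ⟸ the three prints ∧ `RegTower.SingFullTowerConjecture` ∧ `RegTower.SingTowerConjecture p e 1` (e ≥ 4) — both OUR candidates,
HELD (registered only if their falsifiers report clean). [OURS · conditional-result] -/
theorem fInjectiveMacaulayfication_of_threePrints_of_singTowers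
    (hG : CossartPiltant2019General.{0}) (h081R : Stacks081R.{0}) (hM : CesnaviciusBlowupMacaulayficationOffClosed.{0})
    (hSF : RegTower.SingFullTowerConjecture) (hRR : ∀ p e : ℕ, p.Prime → 4 ≤ e → RegTower.SingTowerConjecture p e 1) :
    Summit.ResolutionOfSingularities.ResolutionOfSingularities.Theses.FrobeniusLadder.FInjectiveMacaulayfication :=
  RegTower.fInjectiveMacaulayfication_of_prints_of_singTowers hG h081R
    Summit.ResolutionOfSingularities.ResolutionOfSingularities.Theorems.CP2008Prop44.CossartPiltant2019Principalization_holds.{0} hM hSF hRR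

end Summit.ResolutionOfSingularities.ResolutionOfSingularities.Theorems.FInjectiveMacaulayfication.StepDoorThreePrints

end
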